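import Literature.AlgebraicGeometry.Frobenioids.FrobenioidRealificationRemark521
import Literature.AlgebraicGeometry.Frobenioids.UnitTrivializationPerfectionModelHolds
import Literature.AlgebraicGeometry.Frobenioids.BaseFrobeniusSectionsClosures
import Literature.AlgebraicGeometry.Frobenioids.ModelFrobenioidBiratNormalized
import Literature.AlgebraicGeometry.Frobenioids.BiratLocalization
import Literature.AlgebraicGeometry.Frobenioids.DegreeModelFrobenioid
import Mathlib.Analysis.SpecialFunctions.Log.Basic
import Mathlib.CategoryTheory.Discrete.Basic
import HarnessLib

/-!
# Frobenioids I, §3 / §5: six FACT-LIST schema rows — the universal closures DECIDED in kernel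
# (`PreservesObj`, `PreservesRel`, `Prop53_untrPf`, `Remark521`, `Remark521_ex46`, `RationallyStandardTypeIff`)

Mochizuki, *The geometry of Frobenioids I: the general theory*, Kyushu J. Math. **62** (2008) 293–400:
Thm. 3.4 (i), (v) p. 62–63 [cite: MochizukiFrdI2008, Thm. 3.4 p.62]; Prop. 5.3 p. 103
[cite: MochizukiFrdI2008, Prop. 5.3 p.103]; Remark 5.2.1 p. 103 [cite: MochizukiFrdI2008, Rem. 5.2.1 p.103];
Example 4.6 pp. 86–87 [cite: MochizukiFrdI2008, Ex. 4.6 p.86]; Thm. 5.2 (iii) p. 101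
[cite: MochizukiFrdI2008, Thm. 5.2(iii) p.101].

PROOF-ONLY companion (cell abc-iut, block F, seat abc-iut-f-027 gen 16) of `PreFrobenioidData.lean`,
`FrobenioidRealification.lean` and `ModelFrobenioidStandard.lean`, answering abc-iut-F-lit's LABEL-CHECK list
`plan/LF-REFUTED-WITHOUT-REFUTER.tsv` (2026-08-27T05:19Z): the FACT-LIST rows below carry the label
«universal-closure REFUTED / schema» WITHOUT a kernel refuter of record.  Each of the six declarations is, by its
own docstring, a SCHEMA over a free parameter (an arbitrary predicate / `Prop` / data-interface slot standing for
THE construction of the paper); here the universal closure over the typed binders is REFUTED UNCONDITIONALLY, the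
junk living ONLY in that free slot while every carrier is a GENUINE object of record, and the PROVED instance forms
at THE constructions are cited by name (never restated):

| row | declaration | refuter (this file) | junk slot | instance form PROVED (by name) |
|---|---|---|---|---|
| F-1233 | `PreFrobenioidData.PreservesObj Ψ P₁ P₂` | `not_forall_preservesObj` | `P₁ := ⊤`, `P₂ := ⊥` on `Ψ = 𝟭 pt` | `preservesObj_isIsotropic_of_isFrobenioid` (p450188) |
| F-1234 | `PreFrobenioidData.PreservesRel Ψ R₁ R₂` | `not_forall_preservesRel` | `R₁ := ⊤`, `R₂ := ⊥` | `preservesRel_baseEquivalent_of_isFrobenioid` (p450188) |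
| F-1097 | `PreFrobenioid.Prop53_untrPf F IsOfModelType SU PU` | `DegreeModel.not_forall_prop53_untrPf`, `PreFrobenioid.not_forall_prop53_untrPf` | the PREDICATE `IsOfModelType := ⊥`; `F`, `SU`, `PU` = THE constructions over the degree model | `prop53_untrPf_holds'` (p425890), `prop53_untrPf_holds_of_isOfFSMType`; closed here: `DegreeModel.prop53_untrPf_holds` |
| F-1098 | `PreFrobenioid.Remark521 F₀ B₀ Supp` | `DegreeModel.not_remark521`, `PreFrobenioid.not_forall_remark521` | `F₀ :=` the degree model (a Frobenioid OF MODEL TYPE, so "not of model type" fails) — `F₀` stands in print for THE Frobenioid of Ex. 4.6 | `remark521_ex46_of_ne_zero` (p424714) |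
| F-1099 | `PreFrobenioid.Remark521_ex46 P B₀ Supp` | `PreFrobenioid.not_forall_remark521_ex46` | `Supp := ⊤` ("everything supported at every prime" — strict rationality, Def. 4.5 (ii), then fails at `A₀`) | `remark521_ex46_holds` (p424714); closed here with NO hypothesis: `PreFrobenioid.exists_datum_remark521_ex46` |
| F-1120 | `ModelFrobenioid.RationallyStandardTypeIff Φ B DivB rs r fc` | `DegreeModel.not_forall_rationallyStandardTypeIff`, `…_allData` | the `Prop`s `rs := True`, `r := False` (the docstring's own example) | `rationallyStandardTypeIff_rsParams` (p450657), `rationallyStandardTypeIff_biratData` (p456408) |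

On the way (no definition — the datum is produced inside an `∃`): **Example 4.6 has data with ALL `ξ_p ≠ 0`**
(`Ex46.exists_datum_forall_prime_ne_zero`: `G := ℝ`, `Ξ(n) := n · log n`, Leibniz rule `Ξ(mn) = m Ξ(n) + n Ξ(m)`,
`Ξ(p) = p log p ≠ 0`), so the hypothesis of `Remark521_ex46` / `remark521_ex46_holds` is NON-VACUOUS and Remark 5.2.1
holds at THE Frobenioid of Example 4.6 for that datum with no hypothesis left (`exists_datum_remark521_ex46`).

HONEST FRAMING.  Bookkeeping about the typing only: a predicate on a free slot has instances on both sides; the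
printed sentences are the instances at THE constructions, PROVED in the tree (table).  Refuted-as-typed ≠
refuted-in-print; no statement of the paper is strengthened or denied; no `def`, no `instance`, no new named fact;
nothing here bears on [IUTchIII] Cor. 3.12; no side taken.
-/

noncomputable section

namespace Literature.AlgebraicGeometry.Frobenioids

open CategoryTheory Opposite

/-! ### F-1233 / F-1234: the §3 transport vocabulary `PreservesObj`, `PreservesRel` -/

namespace PreFrobenioidData

/-- **F-1233 (`PreservesObj`): the universal closure is FALSE.**  "`Ψ` preserves a class of objects" is a
schema in the two classes; the identity functor of the one-object discrete category does not carry the class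
"every object" into the class "no object".  Instance form of record (Thm. 3.4 (i), isotropic objects along an
equivalence of Frobenioids): `preservesObj_isIsotropic_of_isFrobenioid`. [cite: MochizukiFrdI2008, Thm. 3.4 (i) p.62] -/
theorem not_forall_preservesObj :
    ¬ ∀ (C₁ : Type) [Category.{0} C₁] (C₂ : Type) [Category.{0} C₂] (Ψ : C₁ ⥤ C₂)
        (P₁ : C₁ → Prop) (P₂ : C₂ → Prop), PreservesObj Ψ P₁ P₂ :=
  fun h => h (Discrete PUnit) (Discrete PUnit) (𝟭 _) (fun _ => True) (fun _ => False)
    (A := ⟨PUnit.unit⟩) trivial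

/-- **F-1234 (`PreservesRel`): the universal closure is FALSE.**  "`Ψ` preserves a relation on co-objective
arrows" is a schema in the two relations; the identity functor does not carry the total relation into the empty
one (tested on the pair `(𝟙, 𝟙)`).  Instance form of record (Thm. 3.4 (v), base-equivalent pairs):
`preservesRel_baseEquivalent_of_isFrobenioid`. [cite: MochizukiFrdI2008, Thm. 3.4 (v) p.63] -/
theorem not_forall_preservesRel :
    ¬ ∀ (C₁ : Type) [Category.{0} C₁] (C₂ : Type) [Category.{0} C₂] (Ψ : C₁ ⥤ C₂)
        (R₁ : ∀ ⦃A B : C₁⦄, (A ⟶ B) → (A ⟶ B) → Prop) (R₂ : ∀ ⦃A B : C₂⦄, (A ⟶ B) → (A ⟶ B) → Prop),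
        PreservesRel Ψ R₁ R₂ :=
  fun h => h (Discrete PUnit) (Discrete PUnit) (𝟭 _) (fun _ _ _ _ => True) (fun _ _ _ _ => False)
    (𝟙 (⟨PUnit.unit⟩ : Discrete PUnit)) (𝟙 _) trivial

end PreFrobenioidData

/-! ### F-1097 / F-1098 / F-1120 over the degree model `(pt, ℕ, 0, 0)` -/

namespace DegreeModel

/-- **F-1097 (`Prop53_untrPf`) at THE constructions over the degree model, NO binder left** (Prop. 5.3,
"`(C^un-tr)^pf` is of model type and is the model Frobenioid of `(Φ^pf, ℚ · Φ^birat)`"): the base `pt` is of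
FSM-type, so abc-iut-L1-d5's `prop53_untrPf_holds_of_isOfFSMType` applies to the Frobenioid `DegreeModel.F`.
[cite: MochizukiFrdI2008, Prop. 5.3 p.103] -/
theorem prop53_untrPf_holds :
    PreFrobenioid.Prop53_untrPf F
      (fun S => ∃ (hS : PreFrobenioid.IsFrobenioid S.toFunctor)
        (hsq : PreFrobenioid.HasBiratSquares S.toFunctor), PreFrobenioid.IsOfModelType S.toFunctor hS hsq)
      (PreFrobenioidData.ofFunctor natΦ (PreFrobenioid.untrFunctor hF))
      (PreFrobenioidData.perfection (PreFrobenioid.isFrobenioid_untr hF)) :=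
  PreFrobenioid.prop53_untrPf_holds_of_isOfFSMType hF isOfFSMType_D

/-- **F-1097 (`Prop53_untrPf`): the closure over the PREDICATE slot is FALSE** — at the SAME genuine data
(`F` the degree model, `SU`/`PU` THE unit-trivialisation and THE perfection datum) the junk predicate
`IsOfModelType := ⊥` ("no operations are of model type") makes the first conjunct of the conclusion `False`,
while the antecedent `IsFrobenioid F` is DISCHARGED (`DegreeModel.hF`).  The declaration's docstring: SCHEMA in
`SU`, `PU`, `IsOfModelType`. [cite: MochizukiFrdI2008, Prop. 5.3 p.103] -/
theorem not_forall_prop53_untrPf :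
    ¬ ∀ IsOfModelType : ∀ {X : Type} [Category.{0} X], PreFrobenioidData.{0} X D → Prop,
        PreFrobenioid.Prop53_untrPf F IsOfModelType
          (PreFrobenioidData.ofFunctor natΦ (PreFrobenioid.untrFunctor hF))
          (PreFrobenioidData.perfection (PreFrobenioid.isFrobenioid_untr hF)) :=
  fun h => (h (fun _ => False) hF).1

/-- **F-1098 (`Remark521`) FAILS at the degree model**: `Remark521 F₀ B₀ Supp` asserts of ITS ARGUMENT `F₀`
(standing, per its docstring, for THE Frobenioid of Example 4.6) that it is "not of model type"; the degree model
IS of model type — pre-model (abc-iut-L1's `DegreeModel.isOfPreModelType`, Def. 2.7 (iii)) and birationally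
Frobenius-normalized at THE birationalization (Thm. 5.2 (ii), `ModelFrobenioid.isOfBiratFrobeniusNormalizedType_of_isDivisorial`)
— so the sixth conjunct fails, for every support predicate. [cite: MochizukiFrdI2008, Rem. 5.2.1 p.103] -/
theorem not_remark521
    (Supp : ∀ {X : D}, (PreFrobenioidData.ofFunctor natΦ F).Mon X →
      Primes ((PreFrobenioidData.ofFunctor natΦ F).Mon X) → Prop) :
    ¬ PreFrobenioid.Remark521 F
        (PreFrobenioid.biratData hF (PreFrobenioid.hasBiratSquares_of_isFrobenioid hF)) Supp :=
  fun h => h.2.2.2.2.2 ⟨isOfPreModelType,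
    ModelFrobenioid.isOfBiratFrobeniusNormalizedType_of_isDivisorial hF _
      objectwise_isDivisorial_natΦ objectwise_isGroupLike_B⟩

/-- **F-1120 (`RationallyStandardTypeIff`, UNPRIMED): the closure over the `Prop` slots is FALSE** — exactly
the docstring's own junk example `RationallyStandardTypeIff Φ B DivB True False _ ↔ ¬ Hypotheses Φ B`, at the
degree model where the hypotheses of Thm. 5.2 HOLD (`DegreeModel.hypotheses`): with "rationally standard" read
as `True` and "rational" as `False` the printed `iff` would give `False`.  Instance forms of record at THE Def. 4.5
data: `rationallyStandardTypeIff_rsParams` (p450657), `rationallyStandardTypeIff_biratData` (p456408); the primed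
re-binding's closure was refuted by abc-iut-f-042 (`not_forall_rationallyStandardTypeIff'`).
[cite: MochizukiFrdI2008, Thm. 5.2(iii) p.101] -/
theorem not_forall_rationallyStandardTypeIff :
    ¬ ∀ (IsOfRationallyStandardType IsOfRationalType : Prop) (CunTrBirat : Type)
        (IsFrobeniusCompactIn : CunTrBirat → Prop),
        ModelFrobenioid.RationallyStandardTypeIff natΦ B DivB IsOfRationallyStandardType IsOfRationalType
          IsFrobeniusCompactIn :=
  fun h => ((h True False PUnit (fun _ => True) hypotheses).mp trivial).1.1

/-- The same refutation read as the closure over ALL model-Frobenioid data `(D, Φ, B, Div_B)` and all slots.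
[cite: MochizukiFrdI2008, Thm. 5.2(iii) p.101] -/
theorem not_forall_rationallyStandardTypeIff_allData :
    ¬ ∀ (D : Type) [Category.{0} D] (Φ B : Dᵒᵖ ⥤ CommMonCat.{0}) (DivB : B ⟶ monoidGp Φ)
        (IsOfRationallyStandardType IsOfRationalType : Prop) (CunTrBirat : Type)
        (IsFrobeniusCompactIn : CunTrBirat → Prop),
        ModelFrobenioid.RationallyStandardTypeIff Φ B DivB IsOfRationallyStandardType IsOfRationalType
          IsFrobeniusCompactIn :=
  fun h => not_forall_rationallyStandardTypeIff (h _ natΦ B DivB)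

end DegreeModel

namespace PreFrobenioid

/-- **F-1097 (`Prop53_untrPf`): the fully quantified closure (universe `0`) is FALSE** — witness the degree
model with THE `SU`, `PU` and the junk predicate `⊥` (`DegreeModel.not_forall_prop53_untrPf`).  Printed
Prop. 5.3 = the instance at THE predicate "Frobenioid of model type" (`prop53_untrPf_holds'`,
`DegreeModel.prop53_untrPf_holds`). [cite: MochizukiFrdI2008, Prop. 5.3 p.103] -/
theorem not_forall_prop53_untrPf :
    ¬ ∀ (D : Type) [Category.{0} D] (Φ : Dᵒᵖ ⥤ CommMonCat.{0}) (C : Type) [Category.{0} C]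
        (F : C ⥤ ElemFrobenioid Φ)
        (IsOfModelType : ∀ {X : Type} [Category.{0} X], PreFrobenioidData.{0} X D → Prop)
        (SU : PreFrobenioidData.{0} (PreFrobenioidData.ofFunctor Φ F).Untr D) (PU : PerfectionData SU),
        Literature.AlgebraicGeometry.Frobenioids.PreFrobenioid.Prop53_untrPf F IsOfModelType SU PU :=
  fun h => DegreeModel.not_forall_prop53_untrPf fun I => h _ _ _ DegreeModel.F I _ _

/-- **F-1098 (`Remark521`): the fully quantified closure (universe `0`) is FALSE** — witness the degree model
(`DegreeModel.not_remark521`), a Frobenioid OF model type, at THE birationalization and any support predicate.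
The printed Remark 5.2.1 is the instance at THE Frobenioid of Example 4.6, PROVED (`remark521_ex46_of_ne_zero`,
`remark521_ex46_holds`, and `exists_datum_remark521_ex46` below). [cite: MochizukiFrdI2008, Rem. 5.2.1 p.103] -/
theorem not_forall_remark521 :
    ¬ ∀ (D₀ : Type) [Category.{0} D₀] (Φ₀ : D₀ᵒᵖ ⥤ CommMonCat.{0}) (C₀ : Type) [Category.{0} C₀]
        (F₀ : C₀ ⥤ ElemFrobenioid Φ₀)
        (B₀ : PreFrobenioidData.BiratData.{0, 0, 0, 0, 0, 0} (PreFrobenioidData.ofFunctor Φ₀ F₀))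
        (Supp : ∀ {X : D₀}, (PreFrobenioidData.ofFunctor Φ₀ F₀).Mon X →
          Primes ((PreFrobenioidData.ofFunctor Φ₀ F₀).Mon X) → Prop),
        Literature.AlgebraicGeometry.Frobenioids.PreFrobenioid.Remark521 F₀ B₀ Supp :=
  fun h => DegreeModel.not_remark521 (fun _ _ => True) (h _ _ _ DegreeModel.F _ _)

end PreFrobenioid

/-! ### F-1099: Example 4.6 with ALL `ξ_p ≠ 0` (`Ξ(n) = n log n`), and the support slot of `Remark521_ex46` -/

namespace Ex46

/-- **Example 4.6 admits data with every `ξ_p ≠ 0`** (the case Remark 5.2.1 is about): over `G := ℝ` put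
`Ξ(n) := n · log n`; the Leibniz rule `Ξ(mn) = m·Ξ(n) + n·Ξ(m)` is `log(mn) = log m + log n`, and
`Ξ(p) = p log p ≠ 0` for every prime `p` (indeed for every `n ≥ 2`).  Hence the hypothesis "`∀ p` prime,
`Ξ(p) ≠ 0`" of `Remark521_ex46` is non-vacuous. [cite: MochizukiFrdI2008, Ex. 4.6 p.86] -/
theorem exists_datum_forall_prime_ne_zero :
    ∃ P : Datum ℝ, ∀ p : ℕ+, (p : ℕ).Prime → P.Ξ p ≠ 0 := by
  refine ⟨⟨fun n => (n : ℝ) * Real.log n, fun m n => ?_⟩, fun p hp => ?_⟩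
  · have hm : ((m : ℕ) : ℝ) ≠ 0 := Nat.cast_ne_zero.mpr m.ne_zero
    have hn : ((n : ℕ) : ℝ) ≠ 0 := Nat.cast_ne_zero.mpr n.ne_zero
    simp only [PNat.mul_coe, Nat.cast_mul, zsmul_eq_mul, Int.cast_natCast]
    rw [Real.log_mul hm hn]
    ring
  · have hp2 : (2 : ℝ) ≤ (p : ℕ) := by exact_mod_cast hp.two_le
    have hlog : 0 < Real.log (p : ℕ) := Real.log_pos (by linarith)
    have hpos : (0 : ℝ) < (p : ℕ) := by linarith
    exact (mul_pos hpos hlog).ne'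

end Ex46

namespace PreFrobenioid

/-- **Remark 5.2.1 at THE Frobenioid of Example 4.6, NO hypothesis left**: for the datum `Ξ(n) = n log n`
(all `ξ_p ≠ 0`), "the Frobenioid '`C`' of Example 4.6 [is] of isotropic, standard, and [strictly] rational
type, [and] not of group-like or model type" — at THE birationalization and the canonical support predicate
(abc-iut-E-t32's `remark521_ex46_holds` with its hypothesis discharged). [cite: MochizukiFrdI2008, Rem. 5.2.1 p.103] -/
theorem exists_datum_remark521_ex46 :
    ∃ P : Ex46.Datum ℝ, (∀ p : ℕ+, (p : ℕ).Prime → P.Ξ p ≠ 0) ∧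
      Literature.AlgebraicGeometry.Frobenioids.PreFrobenioid.Remark521 (Ex46.toElem P)
        (PreFrobenioid.biratData (Ex46.isFrobenioid P)
          (hasBiratSquares_of_isFrobenioid (Ex46.isFrobenioid P)))
        (fun a 𝔭 => PrimarySupp a 𝔭) := by
  obtain ⟨P, hP⟩ := Ex46.exists_datum_forall_prime_ne_zero
  exact ⟨P, hP, remark521_ex46_holds P hP⟩

/-- **F-1099 (`Remark521_ex46`): the closure over the SUPPORT slot is FALSE.**  For the datum `Ξ(n) = n log n`
(so the antecedent "all `ξ_p ≠ 0`" HOLDS), THE birationalization, and the junk support predicate `Supp := ⊤`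
("every element is supported at every prime"), the fourth conjunct "every object is strictly rational"
(Def. 4.5 (ii): some `b` with `𝔭 ∉ Supp(b)`) fails at the object `A₀` and the prime of `(1, 0) ∈ ℤ_{≥0}²`.
The declaration's docstring: SCHEMA in `B₀` and `Supp`; instance form of record at the canonical support
predicate: `remark521_ex46_holds` (p424714). [cite: MochizukiFrdI2008, Rem. 5.2.1 p.103] -/
theorem not_forall_remark521_ex46 :
    ¬ ∀ (G : Type) [AddCommGroup G] (P : Ex46.Datum G)
        (B₀ : PreFrobenioidData.BiratData.{0, 0, 0, 0, 0, 0} (PreFrobenioidData.ofFunctor Ex46.Φ (Ex46.toElem P)))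
        (Supp : ∀ {X}, (PreFrobenioidData.ofFunctor Ex46.Φ (Ex46.toElem P)).Mon X →
          Primes ((PreFrobenioidData.ofFunctor Ex46.Φ (Ex46.toElem P)).Mon X) → Prop),
        Literature.AlgebraicGeometry.Frobenioids.PreFrobenioid.Remark521_ex46 P B₀ Supp := by
  intro h
  obtain ⟨P, hP⟩ := Ex46.exists_datum_forall_prime_ne_zero
  have hR := h ℝ P (PreFrobenioid.biratData (Ex46.isFrobenioid P)
    (hasBiratSquares_of_isFrobenioid (Ex46.isFrobenioid P))) (fun _ _ => True) hP
  -- the prime of `(1, 0)` at the base of `A₀`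
  have h10 : IsPrimary (Multiplicative.ofAdd (((1 : ℕ), (0 : ℕ))) : Multiplicative (ℕ × ℕ)) :=
    (Ex46.isPrimary_iff _).mpr (Or.inl ⟨one_ne_zero, rfl⟩)
  obtain ⟨_, _, -, -, hb⟩ := hR.2.2.2.1 (Ex46.A₀ P) (Quotient.mk (primarySetoid _) ⟨_, h10⟩)
  exact hb trivial

end PreFrobenioid

end Literature.AlgebraicGeometry.Frobenioids

end
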